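import Literature.NumberTheory.EllipticCurves.FormalGroupHeightTwoAtSupersingularPlaceProofs
import Literature.NumberTheory.EllipticCurves.TorsionCardinality
import HarnessLib

/-!
# Serre's contraction estimate for multiplication by `p` at a supersingular place, via division
# polynomials: `|x(pP)| ≥ min(|x(P)|^{p²}, |x(P)|/μ)` on the kernel of reduction (proofs only)

`Proofs`-style file (THEOREMS ONLY: no definition, no named fact, no instance), topic
`NumberTheory/EllipticCurves`; sequel of `FormalGroupHeightTwoAtSupersingularPlaceProofs`.

J.-P. Serre, *Sur les groupes de Galois attachés aux groupes p-divisibles* (Driebergen 1966), §5,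
proof of Lemme 3: for a one-dimensional formal group of height `h` over a complete discretely valued
`K` with `[p](X) = Σ aₙ Xⁿ`, `aₙ ∈ 𝔪` for `n < p^h`, one has `v([p]x) ≥ φ(v(x))`,
`φ(α) = min(p^h α, α + c₁)`, `c₁ = inf_{n<p^h} v(aₙ) > 0` — the estimate from which the ramification
bound `e(K(x)/K) ≥ c·p^{nh}` for `x` of exact order `pⁿ` follows by iteration. This file proves the
estimate for the formal group of an elliptic curve at a place of good SUPERSINGULAR reduction (`h = 2`)
in the tree's chart-free language of `x`-coordinates and DIVISION POLYNOMIALS, avoiding the evaluation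
of power series at points (which the tree has only over `ℚ_p`): for an affine point `P = (x, y)` of
the kernel of reduction (`|x| > 1`; the formal parameter is `z = -x/y`, `|z|² = |x|⁻¹`) with
`pP = (x', y')`, Silverman AEC Exercise 3.7(d) gives `x'·ΨSq_p(x) = Φ_p(x)` (tree:
`mul_eval_ΨSq_of_zsmul_eq`), where `Φ_p = X^{p²} + ⋯` is monic with integral coefficients — so
`|Φ_p(x)| = |x|^{p²}` — and at a supersingular fibre `ΨSq_p ≡ c ≢ 0 (mod 𝔪)` is CONSTANT (Debry's
criterion, tree `exists_ΨSq_prime_eq_C_of_hasseCoeff_eq_zero`; `p` odd), so all its coefficients of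
positive degree have absolute value `≤ μ < 1` and `|ΨSq_p(x)| ≤ max(1, μ|x|^{p²-1})`. Hence

* `valuation_X_pow_sq_le_or_le_mul_of_zsmul_eq` — **`|x'| ≥ |x|^{p²}` or `μ·|x'| ≥ |x|`**, i.e.
  `|x(pP)| ≥ min(|x(P)|^{p²}, |x(P)|/μ)`; in the formal parameter, `v(z(pP)) ≥ min(p² v(z(P)),
  v(z(P)) + ½ v(μ⁻¹))` — Serre's `φ` with `h = 2` (abstract form: any valued field, any Weierstrass
  equation with `|coeff Φ_p| ≤ 1` and `|coeff_j ΨSq_p| ≤ μ` for `j ≥ 1`);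
* `coeff_ΨSq_prime_mem_maximalIdeal_of_hasseCoeff_residue_eq_zero` — over a local ring `R` with
  finite residue field of odd characteristic `p`: if `M mod 𝔪` is elliptic with Hasse invariant `0`,
  then `coeff_j ΨSq_p(M) ∈ 𝔪_R` for every `j ≥ 1` (the supersingular hypothesis of the estimate);
* `coeff_ΨSq_prime_localMinimalIntegralModel_mem_maximalIdeal` — the number-field instance: at a
  finite place `v ∋ p` (`p` odd) with `W.HasGoodReductionAt v` and `¬ W.HasUnitRootAt v`, the
  positive-degree coefficients of `ΨSq_p` of the local minimal integral model `W.localMinimalIntegralModel v`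
  lie in `𝔪_v`;
* `valuation_X_pow_sq_le_or_le_mul_of_zsmul_eq_map` — the estimate for the base change `M.map φ` of an
  `R`-model along any `φ : R →+* L` into a valued field with `|φ(R)| ≤ 1`, granted
  `|φ(coeff_j ΨSq_p(M))| ≤ μ` (`j ≥ 1`) — the form in which the iteration over `pⁿ`-torsion in
  extensions `L ⊇ K_v` consumes it.

What is NOT here: the iteration along a `p`-divisible chain and the ramification/degree
contradiction (Serre's Lemme 3 proper and Prop. 8); `p = 2`.

## References

* J.-P. Serre, Proc. Conf. Local Fields (Driebergen 1966), Springer 1967, §5, proof of Lemme 3.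
  [Serre1967GroupesPDivisibles]
* J. H. Silverman, *The Arithmetic of Elliptic Curves*, 2nd ed. (2009), Exercise 3.7(b),(d), IV.7.5,
  V.3.1(a), VII.2. [SilvermanAEC2009]
-/

noncomputable section

open scoped Classical NNReal

namespace WeierstrassCurve

open Polynomial Literature.NumberTheory.EllipticCurves NumberField IsDedekindDomain IsLocalRing

/-! ### The abstract estimate over a valued field -/

section Valued

variable {L : Type*} [Field L] (w : Valuation L ℝ≥0) (W : WeierstrassCurve L) (p : ℕ)
  [hp : Fact p.Prime]

omit hp in
/-- `|Φ_p(x)| = |x|^{p²}` for `|x| > 1` when `Φ_p` has integral coefficients: the monic top term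
dominates (`Φ_p = X^{p²} + ⋯`, Silverman AEC Exercise 3.7(b); Mathlib `coeff_Φ`, `natDegree_Φ_le`).
[cite: SilvermanAEC2009, Exercise 3.7(b)] -/
theorem valuation_eval_Φ_eq_pow (hΦ : ∀ j, w ((W.Φ p).coeff j) ≤ 1) {x : L} (hx : 1 < w x) :
    w ((W.Φ (p : ℤ)).eval x) = w x ^ (p ^ 2) := by
  set N := p ^ 2 with hN
  have hnat : ((p : ℤ)).natAbs ^ 2 = N := by rw [Int.natAbs_natCast]
  have hdeg : (W.Φ (p : ℤ)).natDegree < N + 1 :=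
    Nat.lt_succ_of_le ((W.natDegree_Φ_le (p : ℤ)).trans (by rw [hnat]))
  have htop : (W.Φ (p : ℤ)).coeff N = 1 := by rw [← hnat]; exact W.coeff_Φ (p : ℤ)
  rw [eval_eq_sum_range' hdeg, Finset.sum_range_succ, htop, one_mul]
  have hx0 : w x ≠ 0 := ne_of_gt (lt_trans zero_lt_one hx)
  have hlt : w (∑ i ∈ Finset.range N, (W.Φ (p : ℤ)).coeff i * x ^ i) < w x ^ N := by
    refine Valuation.map_sum_lt w (pow_ne_zero _ hx0) fun i hi => ?_
    rw [Valuation.map_mul, Valuation.map_pow]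
    have hi' : i < N := Finset.mem_range.mp hi
    calc w ((W.Φ (p : ℤ)).coeff i) * w x ^ i ≤ 1 * w x ^ i :=
          mul_le_mul_of_nonneg_right (hΦ i) (by positivity)
      _ = w x ^ i := one_mul _
      _ < w x ^ N := pow_lt_pow_right₀ hx hi'
  have hxN : w (x ^ N) = w x ^ N := Valuation.map_pow w x N
  rw [Valuation.map_add_eq_of_lt_right w (by rw [hxN]; exact hlt), hxN]

/-- `|ΨSq_p(x)| ≤ max(1, μ·|x|^{p²-1})` for `|x| > 1` when the constant coefficient of `ΨSq_p` is
integral and the others have absolute value `≤ μ` (`deg ΨSq_p ≤ p² - 1`, Silverman AEC Exercise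
3.7(b); Mathlib `natDegree_ΨSq_le`). [cite: SilvermanAEC2009, Exercise 3.7(b)] -/
theorem valuation_eval_ΨSq_le (μ : ℝ≥0) (hΨ0 : w ((W.ΨSq p).coeff 0) ≤ 1)
    (hΨ : ∀ j, 1 ≤ j → w ((W.ΨSq p).coeff j) ≤ μ) {x : L} (hx : 1 < w x) :
    w ((W.ΨSq (p : ℤ)).eval x) ≤ max 1 (μ * w x ^ (p ^ 2 - 1)) := by
  set N := p ^ 2 with hN
  have hnat : ((p : ℤ)).natAbs ^ 2 = N := by rw [Int.natAbs_natCast]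
  have hN1 : 1 ≤ N := Nat.one_le_pow _ _ hp.out.pos
  have hdeg : (W.ΨSq (p : ℤ)).natDegree < N := by
    have h := W.natDegree_ΨSq_le (p : ℤ)
    rw [hnat] at h
    omega
  rw [eval_eq_sum_range' hdeg]
  refine Valuation.map_sum_le w fun i hi => ?_
  have hi' : i < N := Finset.mem_range.mp hi
  rw [Valuation.map_mul, Valuation.map_pow]
  rcases Nat.eq_zero_or_pos i with rfl | hi0
  · rw [pow_zero, mul_one]
    exact le_trans hΨ0 (le_max_left _ _)
  · refine le_trans ?_ (le_max_right _ _)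
    calc w ((W.ΨSq (p : ℤ)).coeff i) * w x ^ i ≤ μ * w x ^ i :=
          mul_le_mul_of_nonneg_right (hΨ i hi0) (by positivity)
      _ ≤ μ * w x ^ (N - 1) :=
          mul_le_mul_of_nonneg_left (pow_le_pow_right₀ hx.le (by omega)) (by positivity)

/-- **Serre's contraction estimate at a supersingular fibre, division-polynomial form.** Let `W` be
a Weierstrass equation over a valued field `(L, |·|)` whose `p`-th division polynomials satisfy
`|coeff_j Φ_p| ≤ 1` (all `j`), `|coeff_0 ΨSq_p| ≤ 1` and `|coeff_j ΨSq_p| ≤ μ` for `j ≥ 1` (at a place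
of good supersingular reduction: `ΨSq_p ≡` const `(mod 𝔪)`). Then for an affine point `P = (x, y)`
with `|x| > 1` (kernel of reduction) and `p • P = (x', y')`:
`|x'| ≥ |x|^{p²}` or `μ·|x'| ≥ |x|`, i.e. `|x(pP)| ≥ min(|x(P)|^{p²}, |x(P)|/μ)` — in the formal
parameter `z = -x/y` (`|z|² = |x|⁻¹`): `v(z(pP)) ≥ min(p²·v(z(P)), v(z(P)) + ½·v(μ⁻¹))`, Serre's
`v([p]x) ≥ φ(v(x)) = min(p^h v(x), v(x) + c₁)` with `h = 2`. From `x'·ΨSq_p(x) = Φ_p(x)`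
(Silverman AEC Exercise 3.7(d)). [cite: Serre1967GroupesPDivisibles, §5 Lemme 3 (proof)]
[cite: SilvermanAEC2009, Exercise 3.7(d)] -/
theorem valuation_X_pow_sq_le_or_le_mul_of_zsmul_eq (μ : ℝ≥0)
    (hΦ : ∀ j, w ((W.Φ p).coeff j) ≤ 1) (hΨ0 : w ((W.ΨSq p).coeff 0) ≤ 1)
    (hΨ : ∀ j, 1 ≤ j → w ((W.ΨSq p).coeff j) ≤ μ)
    {x y : L} (h : W.toAffine.Nonsingular x y) (hx : 1 < w x) {x' y' : L}
    (h' : W.toAffine.Nonsingular x' y')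
    (hP : (p : ℤ) • (Affine.Point.some x y h : W.toAffine.Point) = Affine.Point.some x' y' h') :
    w x ^ (p ^ 2) ≤ w x' ∨ w x ≤ μ * w x' := by
  set N := p ^ 2 with hN
  have hN1 : 1 ≤ N := Nat.one_le_pow _ _ hp.out.pos
  have hx0 : 0 < w x := lt_trans zero_lt_one hx
  have key := W.mul_eval_ΨSq_of_zsmul_eq h (p : ℤ) h' hP
  have hval : w x' * w ((W.ΨSq (p : ℤ)).eval x) = w x ^ N := by
    rw [← Valuation.map_mul, key, valuation_eval_Φ_eq_pow w W p hΦ hx]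
  have hbound := valuation_eval_ΨSq_le w W p μ hΨ0 hΨ hx
  rcases le_max_iff.mp hbound with h1 | h2
  · left
    calc w x ^ N = w x' * w ((W.ΨSq (p : ℤ)).eval x) := hval.symm
      _ ≤ w x' * 1 := mul_le_mul_of_nonneg_left h1 (by positivity)
      _ = w x' := mul_one _
  · right
    have hpow : w x ^ N = w x * w x ^ (N - 1) := by
      conv_lhs => rw [← Nat.sub_add_cancel hN1, pow_succ']
    have hle : w x * w x ^ (N - 1) ≤ (μ * w x') * w x ^ (N - 1) := by
      calc w x * w x ^ (N - 1) = w x' * w ((W.ΨSq (p : ℤ)).eval x) := by rw [← hpow, hval]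
        _ ≤ w x' * (μ * w x ^ (N - 1)) := mul_le_mul_of_nonneg_left h2 (by positivity)
        _ = (μ * w x') * w x ^ (N - 1) := by ring
    exact le_of_mul_le_mul_right hle (pow_pos hx0 _)

end Valued

/-! ### The supersingular hypothesis: positive-degree coefficients of `ΨSq_p` lie in `𝔪` -/

section LocalRing

variable {R : Type*} [CommRing R] [IsLocalRing R] [Finite (ResidueField R)] (M : WeierstrassCurve R)
  (p : ℕ) [hp : Fact p.Prime] [CharP (ResidueField R) p]

/-- **At a supersingular fibre `ΨSq_p ≡ c (mod 𝔪)` is constant**: for a Weierstrass equation `M` over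
a local ring `R` with finite residue field `k` of odd characteristic `p`, elliptic reduction
`M mod 𝔪` of Hasse invariant `A_p = 0`, every coefficient of `ΨSq_p(M)` of positive degree lies in
`𝔪_R` (Debry's criterion over `k`: tree `exists_ΨSq_prime_eq_C_of_hasseCoeff_eq_zero`; `ΨSq`
commutes with base change). [cite: SilvermanAEC2009, Exercise 3.7(f) and V.3.1(a)] -/
theorem coeff_ΨSq_prime_mem_maximalIdeal_of_hasseCoeff_residue_eq_zero (hp2 : p ≠ 2)
    [hE : (M.map (residue R)).IsElliptic] (hA : (M.map (residue R)).hasseCoeff p = 0)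
    {j : ℕ} (hj : 1 ≤ j) : (M.ΨSq (p : ℤ)).coeff j ∈ maximalIdeal R := by
  letI : Fintype (ResidueField R) := Fintype.ofFinite _
  obtain ⟨c, -, hc⟩ := (M.map (residue R)).exists_ΨSq_prime_eq_C_of_hasseCoeff_eq_zero p hp2 hA
  rw [← residue_eq_zero_iff, ← Polynomial.coeff_map, ← map_ΨSq, hc, coeff_C, if_neg (by omega)]

end LocalRing

/-! ### Number fields: the local minimal integral model at a place of good supersingular reduction -/

section NumberField

variable {K : Type*} [Field K] [NumberField K] (W : WeierstrassCurve K)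
  (v : HeightOneSpectrum (𝓞 K)) {p : ℕ} [hp : Fact p.Prime]

/-- **The supersingular hypothesis at a place of a number field**: at a finite place `v ∋ p` (`p` odd)
with `W.HasGoodReductionAt v` and `¬ W.HasUnitRootAt v` (good supersingular reduction), the
positive-degree coefficients of `ΨSq_p` of the local minimal integral model over `𝒪_{K_v}` lie in
`𝔪_v` (the reduction is elliptic, `hasGoodReduction_iff_isElliptic_reduction`, and supersingular:
`p ∣ a_v` gives `A_p = 0`, `hasseCoeff_eq_zero_of_dvd_card_add_one_sub_natCard_point`).
[cite: SilvermanAEC2009, V.3.1(a) and Exercise 3.7(f)] -/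
theorem coeff_ΨSq_prime_localMinimalIntegralModel_mem_maximalIdeal (hp2 : p ≠ 2)
    (hv : (p : 𝓞 K) ∈ v.asIdeal) (hgood : W.HasGoodReductionAt v) (hss : ¬ W.HasUnitRootAt v)
    {j : ℕ} (hj : 1 ≤ j) :
    ((W.localMinimalIntegralModel v).ΨSq (p : ℤ)).coeff j ∈ maximalIdeal (v.adicCompletionIntegers K) := by
  set O := v.adicCompletionIntegers K with hO
  set k := ResidueField O with hk
  letI : Fintype k := Fintype.ofFinite k
  have hchar : ringChar k = p := ringChar_residueField_eq v hp.out hv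
  haveI : CharP k p := ringChar.of_eq hchar
  have hred : (W.localMinimalModel v).reduction O = (W.localMinimalIntegralModel v).map (residue O) := rfl
  haveI hE : ((W.localMinimalIntegralModel v).map (residue O)).IsElliptic := by
    rw [← hred]; exact (hasGoodReduction_iff_isElliptic_reduction (R := O)).mp hgood
  have hdvd : (p : ℤ) ∣ (Fintype.card k : ℤ) + 1 -
      Nat.card ((W.localMinimalIntegralModel v).map (residue O)).toAffine.Point := by
    have h := hss
    rw [hasUnitRootAt_iff, not_not, hchar, Nat.card_eq_fintype_card] at h
    rw [← hred]; exact h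
  have hA : ((W.localMinimalIntegralModel v).map (residue O)).hasseCoeff p = 0 :=
    hasseCoeff_eq_zero_of_dvd_card_add_one_sub_natCard_point _ p hp2 hdvd
  exact coeff_ΨSq_prime_mem_maximalIdeal_of_hasseCoeff_residue_eq_zero _ p hp2 hA hj

end NumberField

/-! ### The estimate for the base change of an integral model -/

section BaseChange

variable {R : Type*} [CommRing R] {L : Type*} [Field L] (φ : R →+* L) (w : Valuation L ℝ≥0)
  (M : WeierstrassCurve R) (p : ℕ) [hp : Fact p.Prime]

/-- **Serre's contraction estimate for the base change `M.map φ` of an `R`-model along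
`φ : R → L` into a valued field with `|φ(R)| ≤ 1`**, granted `|φ(coeff_j ΨSq_p(M))| ≤ μ` for `j ≥ 1`
(supplied at a supersingular place by `coeff_ΨSq_prime_mem_maximalIdeal_of_hasseCoeff_residue_eq_zero`
/ `coeff_ΨSq_prime_localMinimalIntegralModel_mem_maximalIdeal` with any `μ < 1` bounding `|φ(𝔪)|` on
those finitely many coefficients): for `P = (x, y)` on `M.map φ` with `|x| > 1` and `p • P = (x', y')`,
`|x'| ≥ |x|^{p²}` or `μ·|x'| ≥ |x|`. [cite: Serre1967GroupesPDivisibles, §5 Lemme 3 (proof)] -/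
theorem valuation_X_pow_sq_le_or_le_mul_of_zsmul_eq_map (μ : ℝ≥0) (hφ : ∀ r, w (φ r) ≤ 1)
    (hΨ : ∀ j, 1 ≤ j → w (φ ((M.ΨSq (p : ℤ)).coeff j)) ≤ μ)
    {x y : L} (h : (M.map φ).toAffine.Nonsingular x y) (hx : 1 < w x) {x' y' : L}
    (h' : (M.map φ).toAffine.Nonsingular x' y')
    (hP : (p : ℤ) • (Affine.Point.some x y h : (M.map φ).toAffine.Point) = Affine.Point.some x' y' h') :
    w x ^ (p ^ 2) ≤ w x' ∨ w x ≤ μ * w x' := by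
  refine valuation_X_pow_sq_le_or_le_mul_of_zsmul_eq w (M.map φ) p μ (fun j => ?_) ?_ (fun j hj => ?_)
    h hx h' hP
  · rw [map_Φ, Polynomial.coeff_map]; exact hφ _
  · rw [map_ΨSq, Polynomial.coeff_map]; exact hφ _
  · rw [map_ΨSq, Polynomial.coeff_map]; exact hΨ j hj

end BaseChange

end WeierstrassCurve

end
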